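import Summits.RiemannHypothesis.RiemannHypothesis.Theorems.TiltedLandingLaw421E3Literal
import Summits.RiemannHypothesis.RiemannHypothesis.Theorems.TiltedLandingLaw421StubAnalyticHeredity
import Summits.RiemannHypothesis.RiemannHypothesis.Theses.EarlyAppointments

/-! # fieldsplit_v2 — the registered line `fieldsplit_v1` (sha d6eb6582e6fa0d53) RE-IMAGED THIN over the LANDED seam + modules, with the
β-low stub REPLACED by the E3 text (director (CA261) A/B; tenure rh-tenure-earlyapp-1 g4 image — NOT registered by tenure: the lead's
`ledger crux write … Lines/fieldsplit_v2.lean` + `ledger skeleton check … --crux stmt-RiemannHypothesis-24774` are the registration verbs).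

Imports (all `Theorems/…`, `--supports stmt-RiemannHypothesis-24774`): seam `…Seam01…10` → C4 modules M1 `…FieldSplitNodeA`, M2 `…FieldSplitNodeB`,
M3–M9, M11 → E3 modules E01 `…E3Lineage` (C1 §L+§S′) → E02 `…E3Cell` (C1 §E…§E4) → E03 `…E3ExitPace` (C4 §I path cut) → E04 `…E3Literal` (C1 g22 §E5).

STUBS (registered targets of this line):
* `stub_isolatedPairDropLow : IsolatedPairDropLow PSealC4` — VERBATIM from v1 (name and statement; `IsolatedPairDropLow` / `PSealC4` are the LANDED
  `RhW07.C12.FieldSplit.*` of M1/M2, token-identical to v1's). Hand α-1's target; its by-name landing survives re-registration unchanged.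
* `stub_restPace : RhW07.E3.Lit.ZExitPaceRest` — NEW (replaces v1's `stub_denseLevelCensusStopLow : DenseLevelCensusStopLow PSealC4`): REST ALONE of the
  Z-exit PACE meter, `ZExitPaceRest := RestBudget PSealC4 (EmptyClass (3/2)) (paceMeter PSealC4 StCol' (CumReady WindowReady) (EmptyClass (3/2)) D_Z)
  (slackBudget 1 (tentMeterMax (3/2))) (tentMeterMax (3/2))`, `D_Z := dZ (3/2) (tentRealNodes (3/2)) lowestRoot` (C4 `exitMeter (tentChildFamily N)
  (tentFamily (3/2)) root` with N := real tent members of the lowest `StCol'` states, root := canonical lowest level-0 state, guarded). The LAW conjunct is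
  a THEOREM (`RhW07.E3.Lit.lineageLaw_DZ` = C1 `lineageLawG_pace` ∘ C4 `exitMeter_tent_le_meterMax`) and is therefore NOT a stub (critic GATE-7 (b)).
  KILL RULE (CA261) A(3): one 𝒜 frame with REST(S³) < 0 under the tokens' exact conventions ⇒ stub-false with the frame.

COMPOSITION (0 sorry outside the stubs): `stub_restPace` ⟹ (E04 `denseLevelCensusStopLow_of_zExitPaceRest`) the v1 β-low statement; with
`stub_isolatedPairDropLow` ⟹ (M2 `descentSigS'_of_fieldSplitLowLow`) `DescentSigS'` ⟹ (Seam05 `law421T_ofS'` + `analyticHeredity_holds`) the ROUTE DECL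
`Summit.RiemannHypothesis.RiemannHypothesis.Theses.EarlyAppointments.TiltedLandingLaw421` BY NAME (`TiltedLandingLaw421_of`).
Typed ≠ proved; a registered skeleton is a plan, not a proof; models (combs), not ζ/Ξ. RH is not proved; `TiltedLandingLaw421` is NOT proved. -/

namespace Summit.RiemannHypothesis.RiemannHypothesis.Cruxes.TiltedLandingLaw421.FieldSplitV1

set_option linter.dupNamespace false

open RhIdea6.G17.W07C7 RhIdea6.G17.W07C7.Rev6 RhIdea6.G18.W07C8.Law421BirthS RhIdea6.G19.W07C11.Seam
open RhIdea6.G20.W07C12.Frac RhIdea6.G20.W07C12.StColP RhW07.C12.FieldSplit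
open RhW07.E3.Lit

/-- STUB (α-low) — VERBATIM from `fieldsplit_v1`: the ISOLATED-PAIR DROP-LOW half of the sealed c12 field split. -/
theorem stub_isolatedPairDropLow : IsolatedPairDropLow PSealC4 := by
  sorry

/-- STUB (E3 text; replaces v1's β-low stub) — `ZExitPaceRest`: the REST budget of the PACE meter of the guarded Z-exit meter `D_Z`
(EMPTY-only exception class, slack budget `S₀`, booking `T₀(3/2)`, μ = 1/4, `StCol'`, `CumReady WindowReady`). -/
theorem stub_restPace : ZExitPaceRest := by
  sorry

/-- analytic heredity: the landed support theorem (`Theorems/TiltedLandingLaw421StubAnalyticHeredity.lean`). -/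
theorem analyticHeredity_holds : AnalyticHereditySig := _root_.stub_analyticHeredity

/-- (K) the E3 text gives back v1's β-low statement (so nothing registered under v1 is lost). -/
theorem denseLevelCensusStopLow_of_restPace (hβ : ZExitPaceRest) : DenseLevelCensusStopLow PSealC4 :=
  denseLevelCensusStopLow_of_zExitPaceRest hβ

/-- (K) the two stubs give the c12 node `DescentSigS'`. -/
theorem descentSigS'_of_stubs (hα : IsolatedPairDropLow PSealC4) (hβ : ZExitPaceRest) : DescentSigS' :=
  descentSigS'_of_zExitPaceRest hβ hα

/-- (K) … and the crux: `DescentSigS'` + analytic heredity ⟹ the route decl (Seam05 `law421T_ofS'`). -/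
theorem law421T_of_stubs (hα : IsolatedPairDropLow PSealC4) (hβ : ZExitPaceRest) :
    Summit.RiemannHypothesis.RiemannHypothesis.Theses.EarlyAppointments.TiltedLandingLaw421 :=
  law421T_ofS' (descentSigS'_of_stubs hα hβ) analyticHeredity_holds

/-- **COMPOSITION** — the registered stubs prove the crux `TiltedLandingLaw421` (route `EarlyAppointments`, stmt-RiemannHypothesis-24774) BY NAME. -/
theorem TiltedLandingLaw421_of :
    Summit.RiemannHypothesis.RiemannHypothesis.Theses.EarlyAppointments.TiltedLandingLaw421 :=
  law421T_of_stubs stub_isolatedPairDropLow stub_restPace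

end Summit.RiemannHypothesis.RiemannHypothesis.Cruxes.TiltedLandingLaw421.FieldSplitV1
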